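import Literature.NumberTheory.EllipticCurves.BSDRootNumberPrimesEquivProofs
import Literature.NumberTheory.EllipticCurves.LFunctionSmulProofs
import HarnessLib

/-!
# The local Euler factor is an invariant of the discretely valued field

Sibling proof file of `Literature.NumberTheory.EllipticCurves.LFunctionSmulProofs` and
`Literature.NumberTheory.EllipticCurves.BSDRootNumberPrimesEquivProofs` (D-0014 append protocol;
everything here is proved, no definitions). Mathlib's local `L`-factor of a Weierstrass curve
over the fraction field `K` of a DVR `R` (`WeierstrassCurve.localPolynomial R W`:
`1 - a T + q T²`, `1 - T`, `1 + T`, `1` according to the reduction type of the *chosen* minimal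
model `W.minimal R`, `a = q + 1 - #W̃(k)`; `WeierstrassCurve.localEulerFactor R W =
(L(T)⁻¹)(q⁻ˢ)`, Silverman *AEC* §C.16) is transported along compatible ring isomorphisms
`ψ : R₁ ≃+* R₂`, `φ : K₁ ≃+* K₂` of DVR / fraction-field pairs (`φ ∘ algebraMap = algebraMap ∘ ψ`):

* `WeierstrassCurve.localPolynomial_map_ringEquiv`: `(X.map φ).localPolynomial R₂ =
  X.localPolynomial R₁` for elliptic `X / K₁`;
* `WeierstrassCurve.localEulerFactor_map_ringEquiv`: the same for `localEulerFactor`.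

As for the local root number (`WeierstrassCurve.localRootNumber_map_ringEquiv`, whose proof this
file copies), this is not a formality: the chosen minimal models of `X` and of `X.map φ` are not
related by `φ`; but `φ (X.minimal R₁)` is an `R₂`-minimal equation (`isMinimal_map_iff`)
`K₂`-isomorphic to `(X.map φ).minimal R₂`, so the reduction type and the number of points of the
reduction agree for the two (Silverman *AEC* VII.1.3(b), VII.2, VII.5.1:
`hasGoodReduction_iff_of_isMinimal_of_eq_smul`, `hasMultiplicativeReduction_iff_…`,
`hasSplitMultiplicativeReduction_iff_…`, `natCard_point_reduction_eq_of_isMinimal_of_eq_smul`),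
while for `φ (X.minimal R₁)` and `X.minimal R₁` they agree by transport
(`hasGoodReduction_map_iff`, `hasMultiplicativeReduction_map_ringEquiv_iff`,
`hasSplitMultiplicativeReduction_map_ringEquiv_iff`, `integralModel_map_ringEquiv`,
`natCard_point_map_ringEquiv`, and `#k₂ = #k₁` through `IsLocalRing.ResidueField.mapEquiv ψ`).

Used for the completions `ℚ_p ≃ K_w` at a place `w` of residue degree and ramification index
one of a number field `K` (the split primes in Deuring's theorem and in Artin formalism:
`L_w(E_K, T) = L_p(E, T)`).

## References

* J. H. Silverman, *The Arithmetic of Elliptic Curves*, GTM 106, 2nd ed. (2009): VII.1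
  Prop. 1.3(b) (PDF pp. 165–166), VII.2 (PDF p. 166), VII.5 Prop. 5.1 (PDF p. 174), App. C §16
  (PDF pp. 390–391). [SilvermanAEC2009]
-/

namespace WeierstrassCurve

section Transport

variable {R₁ K₁ R₂ K₂ : Type*}
  [CommRing R₁] [IsDomain R₁] [IsDiscreteValuationRing R₁] [Field K₁] [Algebra R₁ K₁]
  [IsFractionRing R₁ K₁]
  [CommRing R₂] [IsDomain R₂] [IsDiscreteValuationRing R₂] [Field K₂] [Algebra R₂ K₂]
  [IsFractionRing R₂ K₂]
  (ψ : R₁ ≃+* R₂) (φ : K₁ ≃+* K₂)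
  (hc : ∀ r : R₁, φ (algebraMap R₁ K₁ r) = algebraMap R₂ K₂ (ψ r))

open IsLocalRing Literature.NumberTheory.EllipticCurves

include ψ hc in
/-- **The local polynomial `L_v(T)` is an invariant of the discretely valued field.** For
compatible ring isomorphisms `ψ : R₁ ≃+* R₂`, `φ : K₁ ≃+* K₂` of DVR / fraction-field pairs and
an elliptic `X / K₁`, Mathlib's `localPolynomial` (the case list `1 - aT + qT²`, `1 ∓ T`, `1` on
the chosen minimal model; Silverman *AEC* §C.16) satisfies
`(X.map φ).localPolynomial R₂ = X.localPolynomial R₁`: the image under `φ` of the chosen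
`R₁`-minimal model is an `R₂`-minimal equation `K₂`-isomorphic to the chosen `R₂`-minimal model
of `X.map φ`, and reduction type and number of points of the reduction are invariants of such
(Silverman *AEC* VII.1.3(b), VII.2, VII.5.1) and are transported along `(ψ, φ)`.
[cite: SilvermanAEC2009, App. C §16 (PDF pp. 390–391) with VII.1 Prop. 1.3(b) and VII.5 Prop. 5.1] -/
theorem localPolynomial_map_ringEquiv (X : WeierstrassCurve K₁) [X.IsElliptic] :
    (X.map (φ : K₁ →+* K₂)).localPolynomial R₂ = X.localPolynomial R₁ := by
  classical
  have he := ringEquiv_mem_range_algebraMap_iff ψ φ hc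
  -- the two chosen minimal models, and the image of the first one under `φ`
  obtain ⟨C₁, hC₁⟩ : ∃ C : VariableChange K₁, X.minimal R₁ = C • X := ⟨_, rfl⟩
  obtain ⟨C₂, hC₂⟩ : ∃ C : VariableChange K₂,
      (X.map (φ : K₁ →+* K₂)).minimal R₂ = C • X.map (φ : K₁ →+* K₂) := ⟨_, rfl⟩
  haveI hmin : ((X.minimal R₁).map (φ : K₁ →+* K₂)).IsMinimal R₂ :=
    (isMinimal_map_iff φ he _).mpr inferInstance
  haveI : (X.minimal R₁).IsElliptic := by rw [hC₁]; infer_instance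
  have hΔ : ((X.minimal R₁).map (φ : K₁ →+* K₂)).Δ ≠ 0 :=
    ((X.minimal R₁).map (φ : K₁ →+* K₂)).isUnit_Δ.ne_zero
  have hrel : (X.map (φ : K₁ →+* K₂)).minimal R₂ =
      (C₂ * (C₁.map (φ : K₁ →+* K₂))⁻¹) • (X.minimal R₁).map (φ : K₁ →+* K₂) := by
    rw [hC₂, hC₁, ← map_variableChange, mul_smul, inv_smul_smul]
  -- the four data of the case list agree
  have hg : ((X.map (φ : K₁ →+* K₂)).minimal R₂).HasGoodReduction R₂ ↔
      (X.minimal R₁).HasGoodReduction R₁ := by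
    rw [hasGoodReduction_iff_of_isMinimal_of_eq_smul R₂ hrel, hasGoodReduction_map_iff φ he]
  have hm : ((X.map (φ : K₁ →+* K₂)).minimal R₂).HasMultiplicativeReduction R₂ ↔
      (X.minimal R₁).HasMultiplicativeReduction R₁ := by
    rw [hasMultiplicativeReduction_iff_of_isMinimal_of_eq_smul R₂ hrel hΔ,
      hasMultiplicativeReduction_map_ringEquiv_iff ψ φ hc]
  have hs : ((X.map (φ : K₁ →+* K₂)).minimal R₂).HasSplitMultiplicativeReduction R₂ ↔
      (X.minimal R₁).HasSplitMultiplicativeReduction R₁ := by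
    rw [hasSplitMultiplicativeReduction_iff_of_isMinimal_of_eq_smul R₂ hrel hΔ,
      hasSplitMultiplicativeReduction_map_ringEquiv_iff ψ φ hc]
  have hcount : Nat.card (((X.map (φ : K₁ →+* K₂)).minimal R₂).reduction R₂).toAffine.Point =
      Nat.card ((X.minimal R₁).reduction R₁).toAffine.Point := by
    rw [natCard_point_reduction_eq_of_isMinimal_of_eq_smul R₂ hrel hΔ, reduction,
      integralModel_map_ringEquiv ψ φ hc, map_map]
    have hcomp : (residue R₂).comp (ψ : R₁ →+* R₂) =
        ((ResidueField.mapEquiv ψ : ResidueField R₁ ≃+* ResidueField R₂) :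
          ResidueField R₁ →+* ResidueField R₂).comp (residue R₁) :=
      RingHom.ext fun _ ↦ rfl
    rw [hcomp, ← map_map, natCard_point_map_ringEquiv, reduction]
  -- the residue fields correspond under `IsLocalRing.ResidueField.mapEquiv ψ`
  have hq : Nat.card (ResidueField R₂) = Nat.card (ResidueField R₁) :=
    (Nat.card_congr (ResidueField.mapEquiv ψ).toEquiv).symm
  unfold localPolynomial
  simp only [hg, hm, hs, hcount, hq]

include ψ hc in
/-- **The local Euler factor `L_v(q_v⁻ˢ)⁻¹` is an invariant of the discretely valued field**:
for compatible ring isomorphisms `ψ : R₁ ≃+* R₂`, `φ : K₁ ≃+* K₂` of DVR / fraction-field pairs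
and an elliptic `X / K₁`, Mathlib's `localEulerFactor` (the formal Dirichlet series
`L(T)⁻¹` at `T = q⁻ˢ`, `q = #k`) satisfies
`(X.map φ).localEulerFactor R₂ = X.localEulerFactor R₁` (from `localPolynomial_map_ringEquiv`
and `#k₂ = #k₁`). Silverman *AEC* §C.16 with VII.1.3(b).
[cite: SilvermanAEC2009, App. C §16 (PDF pp. 390–391) with VII.1 Prop. 1.3(b)] -/
theorem localEulerFactor_map_ringEquiv (X : WeierstrassCurve K₁) [X.IsElliptic] :
    (X.map (φ : K₁ →+* K₂)).localEulerFactor R₂ = X.localEulerFactor R₁ := by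
  have hq : Nat.card (ResidueField R₂) = Nat.card (ResidueField R₁) :=
    (Nat.card_congr (ResidueField.mapEquiv ψ).toEquiv).symm
  simp only [localEulerFactor, localPowerSeries, localPolynomial_map_ringEquiv ψ φ hc, hq]

end Transport

end WeierstrassCurve
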